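import Literature.MathematicalPhysics.QuantumFieldTheory.Balaban1983to89.B7Prop3GaugeCarryRec

/-!
# `Balaban1983to89.B7Prop3PureGaugeRec` — [Balaban1985Averaging] PROPOSITION 3 FOR THE RECORD's AVERAGING STRUCTURE ([Balaban1987RG1] (0.4)): LINEARISED AVERAGES MAP COVARIANT PURE GAUGES
# TO COVARIANT PURE GAUGES — «L(Q(V₀)(d_{V₀}μ))_c = (d_{V̄₀} R̄μ)(c)», the linearisation of the covariance (59)∕(93)∕(95) (the `λ ↦ μ` identity of director-ym №265 (2) N2b; road (A′))

statement-level skeleton of published theorems with citation tags; proofs where landed; nothing here is a claim about the Yang–Mills mass gap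

CITATION HEADER (lean-in-tree rule).  Cell `pub-ymgap`, seat `pub-ymgap-dag-n05-e` g36 (N05-REC LEAD PEN); item R1 ([3] layer); the identity that discharges the hypothesis `hgauge` of the
record's k-uniform Prop. 4 induction (`B7Prop4GaugeInductionRec.prop4_gauge_induction`).  `--kind definition --supports stmt-QuantumFields-20541` (K0⁷; count-neutral; ONE small `def`
`dcovF` (the fine covariant derivative) + theorems).  Sources READ: [3] = [Balaban1985Averaging] pp. 27–28 (55)–(59), 30–31 (78)–(82), (93)–(95), 34–36 (112)–(124) (`paper:balaban1985-cmp98-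
averaging`); [I] = [Balaban1987RG1] (0.4) p. 253.  REUSED BY NAME: `B7Prop3GeneralTildRec.linQcovZ_eq` ((120) closed form), `B7Prop3GaugeCarryRec` (`lamZ`, `dcovZ`, `QhatZ`),
`B7SectEFLinearisationRec.rlamZ` ((211)'s R-rotated tree-contour block mean), `B12AverageCorridor267` (`Dmlog`, `Dexp`, `PhiY`, `hasFDerivAt_mlog`), `B7Eq92Concrete.mlog_Rc ∕ expUnit_conj` ((57)).

WHY THIS FILE.  The record's one-step linear part «L(Q(V₀)A)_c» (`linQcovZ`) carries a coarse gauge letter that is not small in `sup|A|` (LOCATED-N2).  What saves the k-uniform induction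
(128)–(133) is EXACT COVARIANCE: the average of a gauge transform is the gauge transform of the average ((59) = (93), `BlockAveragingZdCovariance.bavgZ_gaugeAct_units`), and the double-bar
average (89)∕(95) inherits it through its frames (82).  Linearised at `V₁ = 1` in the direction of an infinitesimal gauge transformation `μ` — whose perturbation field is the FINE covariant
derivative `(d_{V₀}μ)(x, ν) = μ(x) − R(V₀(x,ν))μ(x + e_ν)` — this says: «L(Q(V₀)(d_{V₀}μ))_c = (R̄μ)(c₋) − R(V̄₀(c))(R̄μ)(c₊)», `(R̄μ)(y) = Σ_{x∈B(y)} L^{−d} R(V₀(Γ_{y,x}))μ(x)` the rotated block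
mean along the TREE contours of the frames (= `rlamZ`, the linear part of (78)∕(211)).  I.e. linearised averages map covariant pure gauges to covariant pure gauges with a sup-norm
NON-INCREASING block mean — so carried gauge letters accumulate additively along the levels (`B7Prop4GaugeInductionRec`).  The proof is the closed form (120) (`linQcovZ_eq`) evaluated on
`d_{V₀}μ`: rotated sums of a covariant gradient TELESCOPE (`tsum_dcovF`), the (0.4) loops are closed so their contribution is the commutator `[μ(c₋), log W_i]` under `D log`
(`Dmlog_comm`), and `g(−i ad_Y)` turns `[μ, Y]` into `μ − e^{Y}μe^{−Y}` (`PhiY_comm`).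
WHAT IS PROVED (sorry-free).  §1 `dcovF` and the telescoping ★`tsum_dcovF` (`(R_{0,y}(d_{V₀}μ))(Γ) = μ(y) − R(V₀(Γ))μ(y + Γ)`), `AloopZ_dcovF`, `FhatCovZ_dcovF` (`F̂_{V₀}(d_{V₀}μ)(y) = μ(y) −
(R̄μ)(y)`); §2 the commutator calculus `hasDerivAt_conj_exp`, ★`Dmlog_comm` (`(D log)_W[μ, W] = [μ, log W]`), `Dexp_comm`, `PhiY_comm`; §3 `DXavgZ_dcovF` (`= [μ(c₋), XZ]`), `QprimeCovZ_dcovF`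
(`= μ(c₋) − R(V̄₀(c))μ(c₊)`), ★★★`linQcovZ_dcovF` — THE IDENTITY «L(Q(V₀)(d_{V₀}μ))_c = (d_{V̄₀}R̄μ)(c)» (under the small-loop guard of (120)); §4 the carried letter of a pure gauge:
`lamZ_dcovF` (`λ_{dμ}(y) = mean_i [R(V₀(Γ)) − R(V₀(Γ^σ))]μ(x)` — a pure holonomy defect), ★`norm_lamZ_dcovF_le` (`≤ 2ε″·sup|μ|`, `ε″` the two-staircase loop deviation), ★`QhatZ_dcovF_add`
(the `hgauge` hypothesis of `prop4_gauge_induction` for the record, verbatim shape); §5 `tsum_plaqWord_dcovF`, `norm_tsum_plaqWord_dcovF_le` (the covariant curl of a covariant pure gauge is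
the holonomy defect `μ(x) − R(V₀(∂p))μ(x)`, `≤ 2|V₀(∂p) − 1|·|μ|`).
HONEST SCOPE.  Exact identities and two elementary bounds for OUR typed record objects; nothing of [3]∕[6]∕[I] asserted; `HThm4Rec` UNDISCHARGED; N05 discharged of record untouched; N07 not
claimable; counts unmoved (typed 28∕28 · discharged 8∕28); one finite 𝕋⁴ programme at fixed ε — nothing continuum ∕ ℝ⁴ ∕ OS ∕ mass gap ∕ Clay.  One `def`, no `instance`, no `notation`, no `sorry`.
-/

set_option autoImplicit false

noncomputable section

open scoped BigOperators
open NormedSpace Finset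

namespace Literature.MathematicalPhysics.QuantumFieldTheory.Balaban1983to89.B7Prop3PureGaugeRec

open B7Prop1Explicit hiding Site
open B7Prop1Explicit renaming Site → SiteZ
open MatrixLog B7Prop3GeneralRotated
open B7Eq78Linearization (conjR conjR_apply conjR_add conjR_sub conjR_smul conjR_smul_real conjR_one)
open B7Eq92Concrete (Rc Rc_apply mlog_Rc expUnit_conj)
open B7Eq170Flat (cj bmean bmean_apply bmean_const)
open B12AverageCorridor267 (Dmlog Dexp PhiY PhiY_apply hasFDerivAt_mlog hasFDerivAt_exp_Dexp)
open BlockAveragingZd (offZ IdxZ WZ WZ_def XZ bavgZ bavgZ_apply disp_loopWord)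
open B7SectEFLinearisationRec (FhatCovZ QcovZ linQcovZ AloopZ DXavgZ QprimeCovZ rlamZ)
open B7Prop3FlatRecSide (sum_IdxZ_fst sum_IdxZ_const norm_avgZ_le)
open B7Prop3GeneralTildRec (linQcovZ_eq)
open B7Prop3GaugeCarryRec (lamZ dcovZ QhatZ lamZ_def dcovZ_apply QhatZ_def lamZ_eq_mean linQcovZ_eq_QhatZ_add_dcovZ)
open B8Eq191FlatStencils (conjR_unitOne)
open T4Continuum (loopWord stairWord)

variable {d : ℕ}

variable {𝔸 : Type*} [NormedRing 𝔸] [NormedAlgebra ℂ 𝔸] [NormOneClass 𝔸] [CompleteSpace 𝔸]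
variable (L : ℕ)

/-! ## §1 The fine covariant derivative and the telescoping of rotated sums along covariant gradients -/

section Telescoping

/-- **THE FINE COVARIANT DERIVATIVE** of a site function `μ` in the background `V₀`: `(d_{V₀}μ)(x, ν) := μ(x) − R(V₀(x,ν))μ(x + e_ν)` — the perturbation field of the infinitesimal
gauge transformation `e^{μ}` relative to `V₀` ((55): `V′ ↦ V′^v` with `V′ = 1`, `v = e^{μ}`: `(e^{μ}V₀e^{−μ}V₀⁻¹)(b) = e^{(d_{V₀}μ)(b) + O(μ²)}`). [cite: Balaban1985Averaging, (55)–(56) p.27] -/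
def dcovF (V₀ : SiteZ d → Fin d → 𝔸ˣ) (μ : SiteZ d → 𝔸) : SiteZ d → Fin d → 𝔸 :=
  fun x ν => μ x - conjR (V₀ x ν) (μ (x + e ν))

omit [NormedAlgebra ℂ 𝔸] [NormOneClass 𝔸] [CompleteSpace 𝔸] in
/-- Unfolding `dcovF`. [cite: Balaban1985Averaging, (55)–(56) p.27] -/
theorem dcovF_apply (V₀ : SiteZ d → Fin d → 𝔸ˣ) (μ : SiteZ d → 𝔸) (x : SiteZ d) (ν : Fin d) :
    dcovF V₀ μ x ν = μ x - conjR (V₀ x ν) (μ (x + e ν)) := rfl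

omit [NormedAlgebra ℂ 𝔸] [NormOneClass 𝔸] [CompleteSpace 𝔸] in
/-- ★ **ROTATED SUMS OF A COVARIANT GRADIENT TELESCOPE**: `(R_{0,y}(d_{V₀}μ))(Γ) = μ(y) − R(V₀(Γ))·μ(y + Γ)` for EVERY word `Γ` (both orientations: a reversed letter is rotated by `R(V₀(b)⁻¹)`).
This is the linearisation of «(R_{0,y}V′^v)(Γ_{y,x}) = v(y)(R_{0,y}V′)(Γ_{y,x})R(V₀(Γ_{y,x}))v⁻¹(x)» (the display after (59)) at `V′ = 1`. [cite: Balaban1985Averaging, (58)–(59) p.27] -/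
theorem tsum_dcovF (V₀ : SiteZ d → Fin d → 𝔸ˣ) (μ : SiteZ d → 𝔸) :
    ∀ (y : SiteZ d) (w : List (Letter d)), tsum V₀ (dcovF V₀ μ) y w = μ y - conjR (hol V₀ y w) (μ (y + disp w))
  | y, [] => by simp [conjR_apply]
  | y, l :: w => by
    rw [tsum_cons, tsum_dcovF V₀ μ (y + l.vec) w, hol_cons, conjR_mul_left, disp_cons, ← add_assoc, conjR_sub]
    obtain ⟨ν, b⟩ := l
    cases b
    · -- reversed letter at `y`: the bond is `⟨y − e_ν, y⟩`
      simp only [tstep, stepHol, Letter.vec, Bool.false_eq_true, ↓reduceIte, dcovF_apply]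
      rw [conjR_sub, ← conjR_mul_left, show y + -e ν + e ν = y by abel, inv_mul_cancel, conjR_unitOne]
      abel
    · simp only [tstep, stepHol, Letter.vec, ↓reduceIte, dcovF_apply]
      abel

omit [NormedAlgebra ℂ 𝔸] [NormOneClass 𝔸] [CompleteSpace 𝔸] in
/-- The (0.4) loops are CLOSED, so `A^{(1)}_i(d_{V₀}μ) = μ(c₋) − R(W_i)μ(c₋)` (a commutator with the loop variable). [cite: Balaban1985Averaging, (114)–(115) p.34; Balaban1987RG1, (0.4) p.253] -/
theorem AloopZ_dcovF (V₀ : SiteZ d → Fin d → 𝔸ˣ) (μ : SiteZ d → 𝔸) (q : SiteZ d) (κ : Fin d) (i : IdxZ d L) :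
    AloopZ L V₀ (dcovF V₀ μ) q κ i = μ q - conjR (WZ L V₀ q κ i) (μ q) := by
  unfold AloopZ
  rw [tsum_dcovF, disp_loopWord, add_zero, WZ_def]

omit [NormOneClass 𝔸] [CompleteSpace 𝔸] in
/-- The rotated tree-contour block mean of `B7SectEFLinearisationRec` in this file's letters. [cite: Balaban1985Averaging, (78) p.30, (211) p.49] -/
theorem rlamZ_eq (V₀ : SiteZ d → Fin d → 𝔸ˣ) (f : SiteZ d → 𝔸) (y : SiteZ d) :
    rlamZ L V₀ f y = ∑ r : Fin d → Fin L, (((L : ℝ) ^ d)⁻¹) • conjR (hol V₀ y (treeWord (offZ L r))) (f (y + offZ L r)) := by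
  unfold rlamZ
  rw [bmean_apply]
  rfl

omit [NormOneClass 𝔸] [CompleteSpace 𝔸] in
/-- **The frame of a pure gauge**: `F̂_{V₀}(d_{V₀}μ)(y) = μ(y) − (R̄μ)(y)` — the linearisation of «\overline{R_{0,y}V₁^v} = v(y)·𝓔{R(V₀(Γ_{y,x}))v(x)⁻¹}» ((82)∕(99)).
[cite: Balaban1985Averaging, (112) p.34, (82) p.30, (78) p.30] -/
theorem FhatCovZ_dcovF (hL : 1 ≤ L) (V₀ : SiteZ d → Fin d → 𝔸ˣ) (μ : SiteZ d → 𝔸) (y : SiteZ d) :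
    FhatCovZ L V₀ (dcovF V₀ μ) y = μ y - rlamZ L V₀ μ y := by
  unfold FhatCovZ
  simp only [tsum_dcovF, disp_treeWord, smul_sub, Finset.sum_sub_distrib]
  rw [rlamZ_eq]
  congr 1
  have := bmean_const (d := d) hL (μ y)
  rwa [bmean_apply] at this

end Telescoping

/-! ## §2 The commutator calculus of `log` and `exp` ((57) linearised along a gauge family) -/

section Commutators

omit [NormOneClass 𝔸] in
/-- `d∕dt|₀ (e^{tμ} X e^{−tμ}) = μX − Xμ`. [cite: Balaban1985Averaging, (56)–(57) p.27] -/
theorem hasDerivAt_conj_exp (μ X : 𝔸) :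
    HasDerivAt (fun t : ℂ => exp (t • μ) * X * exp (t • (-μ))) (μ * X - X * μ) 0 := by
  have h1 : HasDerivAt (fun t : ℂ => exp (t • μ)) μ 0 := by
    simpa using hasDerivAt_exp_smul_const' (𝕂 := ℂ) μ 0
  have h2 : HasDerivAt (fun t : ℂ => exp (t • (-μ))) (-μ) 0 := by
    simpa using hasDerivAt_exp_smul_const' (𝕂 := ℂ) (-μ) 0
  have h := (h1.mul_const X).fun_mul h2
  simp only [zero_smul, NormedSpace.exp_zero, one_mul, mul_one, mul_neg] at h
  simpa [sub_eq_add_neg] using h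

omit [NormOneClass 𝔸] in
/-- ★ **`(D log)_W [μ, W] = [μ, log W]`** for `‖W − 1‖ < 1`: differentiate «log(XWX⁻¹) = X(log W)X⁻¹» ((57), `mlog_Rc`) along `X = e^{tμ}`. [cite: Balaban1985Averaging, (57) p.27, (117) p.35] -/
theorem Dmlog_comm (W : 𝔸ˣ) (hW : ‖(W : 𝔸) - 1‖ < 1) (μ : 𝔸) :
    Dmlog (W : 𝔸) (μ * W - W * μ) = μ * mlog (W : 𝔸) - mlog (W : 𝔸) * μ := by
  have hγ := hasDerivAt_conj_exp μ (W : 𝔸)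
  have hγ0 : exp ((0 : ℂ) • μ) * (W : 𝔸) * exp ((0 : ℂ) • (-μ)) = W := by simp
  have h1 : HasDerivAt (fun t : ℂ => mlog (exp (t • μ) * W * exp (t • (-μ)))) (Dmlog (W : 𝔸) (μ * W - W * μ)) 0 :=
    (hasFDerivAt_mlog hW).comp_hasDerivAt_of_eq (0 : ℂ) hγ hγ0.symm
  have h2 : HasDerivAt (fun t : ℂ => exp (t • μ) * mlog (W : 𝔸) * exp (t • (-μ))) (μ * mlog (W : 𝔸) - mlog (W : 𝔸) * μ) 0 :=
    hasDerivAt_conj_exp μ (mlog (W : 𝔸))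
  have heq : (fun t : ℂ => mlog (exp (t • μ) * W * exp (t • (-μ)))) = fun t => exp (t • μ) * mlog (W : 𝔸) * exp (t • (-μ)) := by
    funext t
    have h := mlog_Rc (expUnit (t • μ)) W
    rw [Rc_apply, Units.val_mul, Units.val_mul] at h
    have hv : ((expUnit (t • μ) : 𝔸ˣ) : 𝔸) = exp (t • μ) := rfl
    have hi : (((expUnit (t • μ))⁻¹ : 𝔸ˣ) : 𝔸) = exp (t • (-μ)) := by
      show exp (-(t • μ)) = exp (t • (-μ)); rw [smul_neg]
    rw [hv, hi] at h
    exact h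
  rw [heq] at h1
  exact h1.unique h2

/-- **`(D exp)_Y [μ, Y] = [μ, e^{Y}]`**: differentiate «exp(XYX⁻¹) = X e^{Y} X⁻¹» ((57), `expUnit_conj`) along `X = e^{tμ}`. [cite: Balaban1985Averaging, (57) p.27, (118) p.35] -/
theorem Dexp_comm (Y μ : 𝔸) : Dexp Y (μ * Y - Y * μ) = μ * exp Y - exp Y * μ := by
  have hγ := hasDerivAt_conj_exp μ Y
  have hγ0 : exp ((0 : ℂ) • μ) * Y * exp ((0 : ℂ) • (-μ)) = Y := by simp
  have h1 : HasDerivAt (fun t : ℂ => exp (exp (t • μ) * Y * exp (t • (-μ)))) (Dexp Y (μ * Y - Y * μ)) 0 :=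
    (hasFDerivAt_exp_Dexp Y).comp_hasDerivAt_of_eq (0 : ℂ) hγ hγ0.symm
  have h2 : HasDerivAt (fun t : ℂ => exp (t • μ) * exp Y * exp (t • (-μ))) (μ * exp Y - exp Y * μ) 0 := hasDerivAt_conj_exp μ (exp Y)
  have heq : (fun t : ℂ => exp (exp (t • μ) * Y * exp (t • (-μ)))) = fun t => exp (t • μ) * exp Y * exp (t • (-μ)) := by
    funext t
    have h := congrArg (fun u : 𝔸ˣ => (u : 𝔸)) (expUnit_conj (expUnit (t • μ)) Y)
    simp only [val_expUnit, Rc_apply, Units.val_mul] at h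
    have hi : (((expUnit (t • μ))⁻¹ : 𝔸ˣ) : 𝔸) = exp (t • (-μ)) := by
      show exp (-(t • μ)) = exp (t • (-μ)); rw [smul_neg]
    rw [hi] at h
    exact h
  rw [heq] at h1
  exact h1.unique h2

/-- **`g(−i ad_Y)[μ, Y] = μ − R(e^{Y})μ`** — (117)'s operator `g = (D exp)_Y(·)e^{−Y}` applied to a commutator. [cite: Balaban1985Averaging, (117)–(118) p.35] -/
theorem PhiY_comm (Y μ : 𝔸) : PhiY Y (μ * Y - Y * μ) = μ - conjR (expUnit Y) μ := by
  rw [PhiY_apply, Dexp_comm, conjR_apply, sub_mul, mul_assoc, ← val_expUnit Y]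
  congr 1
  · rw [show exp (-Y) = (((expUnit Y)⁻¹ : 𝔸ˣ) : 𝔸) from rfl, Units.mul_inv, mul_one]

end Commutators

/-! ## §3 «L(Q(V₀)(d_{V₀}μ))_c = (d_{V̄₀} R̄μ)(c)» -/

section Identity

omit [NormOneClass 𝔸] in
/-- **The first exponent of (117) on a pure gauge**: `DXavgZ(d_{V₀}μ) = [μ(c₋), XZ]` (each loop contributes `(D log)_{W_i}[μ, W_i] = [μ, log W_i]`; sum over the (0.4) family).
[cite: Balaban1985Averaging, (117) p.35; Balaban1987RG1, (0.4) p.253] -/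
theorem DXavgZ_dcovF (V₀ : SiteZ d → Fin d → 𝔸ˣ) (μ : SiteZ d → 𝔸) (q : SiteZ d) (κ : Fin d)
    (hW : ∀ i : IdxZ d L, ‖((WZ L V₀ q κ i : 𝔸ˣ) : 𝔸) - 1‖ < 1) :
    DXavgZ L V₀ (dcovF V₀ μ) q κ = μ q * XZ L V₀ q κ - XZ L V₀ q κ * μ q := by
  unfold DXavgZ XZ
  rw [Finset.mul_sum, Finset.sum_mul, ← Finset.sum_sub_distrib]
  refine Finset.sum_congr rfl fun i _ => ?_
  have hA : AloopZ L V₀ (dcovF V₀ μ) q κ i * ((WZ L V₀ q κ i : 𝔸ˣ) : 𝔸) = μ q * WZ L V₀ q κ i - WZ L V₀ q κ i * μ q := by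
    rw [AloopZ_dcovF, conjR_apply, sub_mul, mul_assoc, mul_assoc, Units.inv_mul, mul_one]
  rw [hA, Dmlog_comm _ (hW i), smul_sub, mul_smul_comm, smul_mul_assoc]

/-- **(119) on a pure gauge**: `(Q′(V₀)(d_{V₀}μ))_c = μ(c₋) − R(V̄₀(c))μ(c₊)` — `g(−i ad_Y)[μ, Y] = μ − R(e^{Y})μ` plus the straight segment `R(e^{Y})[μ(c₋) − R(V₀(c))μ(c₊)]`, and
`V̄₀(c) = e^{Y}V₀(c)`. [cite: Balaban1985Averaging, (119) p.35, (42) p.23] -/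
theorem QprimeCovZ_dcovF (V₀ : SiteZ d → Fin d → 𝔸ˣ) (μ : SiteZ d → 𝔸) (q : SiteZ d) (κ : Fin d)
    (hW : ∀ i : IdxZ d L, ‖((WZ L V₀ q κ i : 𝔸ˣ) : 𝔸) - 1‖ < 1) :
    QprimeCovZ L V₀ (dcovF V₀ μ) q κ = μ q - conjR (bavgZ L V₀ q κ) (μ (q + (L : ℤ) • e κ)) := by
  unfold QprimeCovZ
  rw [DXavgZ_dcovF L V₀ μ q κ hW, PhiY_comm, tsum_dcovF, disp_seg, conjR_sub, bavgZ_apply, conjR_mul_left]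
  abel

/-- ★★★ **LINEARISED AVERAGES MAP COVARIANT PURE GAUGES TO COVARIANT PURE GAUGES: «L(Q(V₀)(d_{V₀}μ))_c = (R̄μ)(c₋) − R(V̄₀(c))(R̄μ)(c₊) = (d_{V̄₀}R̄μ)(c)»**, `R̄μ = rlamZ L V₀ μ` the
R-rotated block mean along the tree contours of the frames (82) — the linearisation at `V₁ = 1` of the covariance (95) «\widetilde{V₁^{w⁻¹}} = V̿₁» ∕ (93) of the double-bar average, for
the RECORD's structure (the (0.4) loops are closed, the frames are single-staircase: only the frames' contours survive).  Under the small-loop guard of the closed form (120).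
[cite: Balaban1985Averaging, (93) p.31, (95) p.31, (120) p.35, (124) p.36, (78) p.30; Balaban1987RG1, (0.4) p.253] -/
theorem linQcovZ_dcovF (hL : 1 ≤ L) (V₀ : SiteZ d → Fin d → 𝔸ˣ) (μ : SiteZ d → 𝔸) (q : SiteZ d) (κ : Fin d)
    (hW : ∀ i : IdxZ d L, ‖((WZ L V₀ q κ i : 𝔸ˣ) : 𝔸) - 1‖ < 1) :
    linQcovZ L V₀ (dcovF V₀ μ) q κ = dcovZ L V₀ (rlamZ L V₀ μ) q κ := by
  rw [linQcovZ_eq L V₀ _ q κ hW, QprimeCovZ_dcovF L V₀ μ q κ hW, FhatCovZ_dcovF L hL, FhatCovZ_dcovF L hL, dcovZ_apply, conjR_sub]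
  abel

end Identity

/-! ## §4 The carried letter of a pure gauge is a holonomy defect; the `hgauge` hypothesis of the record's Prop. 4 induction -/

section Carry

omit [NormOneClass 𝔸] [CompleteSpace 𝔸] in
/-- **`λ_{d_{V₀}μ}(y) = Σ_i |IdxZ|⁻¹ [R(V₀(Γ_{y,x})) − R(V₀(Γ^σ_{y,x}))] μ(x)`** — on a pure gauge the carried letter is the holonomy defect between the tree staircase and the σ-staircase
(zero at a flat background; `O(loop deviation)·|μ|` at a regular one). [cite: Balaban1985Averaging, (112) p.34, (124) p.36; Balaban1987RG1, (0.3)–(0.4) pp.252–253] -/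
theorem lamZ_dcovF (hL : 1 ≤ L) (V₀ : SiteZ d → Fin d → 𝔸ˣ) (μ : SiteZ d → 𝔸) (y : SiteZ d) :
    lamZ L V₀ (dcovF V₀ μ) y = ∑ i : IdxZ d L, ((Fintype.card (IdxZ d L) : ℝ))⁻¹ •
      (conjR (hol V₀ y (treeWord (offZ L i.1))) (μ (y + offZ L i.1)) - conjR (hol V₀ y (stairWord i.2.1 (offZ L i.1))) (μ (y + offZ L i.1))) := by
  rw [lamZ_eq_mean L hL]
  refine Finset.sum_congr rfl fun i _ => ?_
  rw [tsum_dcovF, tsum_dcovF, BlockAveragingZd.disp_stairWord, disp_treeWord]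
  abel

omit [CompleteSpace 𝔸] in
/-- ★ **`‖λ_{d_{V₀}μ}(y)‖ ≤ 2ε″·sup|μ|`** where `ε″` bounds the two-staircase loop deviations `‖V₀(Γ_{y,x})·V₀(Γ^σ_{y,x})⁻¹ − 1‖` on the block (`(d·s)²α₀` at a background with
`|V₀(∂p) − 1| ≤ α₀`, `B7Prop3GeneralLinearPdevRec`): on pure gauges the carried letter IS small in `sup`. [cite: Balaban1985Averaging, (124)–(126) p.36, (8) p.18; Balaban1987RG1, (0.3) p.252] -/
theorem norm_lamZ_dcovF_le (hL : 1 ≤ L) {V₀ : SiteZ d → Fin d → 𝔸ˣ} (hV₀ : ∀ x κ, V₀ x κ ∈ U1 𝔸) {μ : SiteZ d → 𝔸} {m : ℝ}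
    (hm : ∀ z, ‖μ z‖ ≤ m) (y : SiteZ d) {ε'' : ℝ}
    (hloop : ∀ (r : Fin d → Fin L) (σ : Equiv.Perm (Fin d)),
      ‖((hol V₀ y (treeWord (offZ L r)) : 𝔸ˣ) : 𝔸) * (((hol V₀ y (stairWord σ (offZ L r)))⁻¹ : 𝔸ˣ) : 𝔸) - 1‖ ≤ ε'') :
    ‖lamZ L V₀ (dcovF V₀ μ) y‖ ≤ 2 * ε'' * m := by
  rw [lamZ_dcovF L hL]
  refine norm_avgZ_le L hL _ fun i => ?_
  set a := hol V₀ y (treeWord (offZ L i.1)) with ha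
  set b := hol V₀ y (stairWord i.2.1 (offZ L i.1)) with hb
  set X := μ (y + offZ L i.1) with hX
  have hb1 : b ∈ U1 𝔸 := hol_mem hV₀ _ _
  -- `R(a)X − R(b)X = R(b)(R(b⁻¹a)X − X)` and `b⁻¹a` is conjugate to `ab⁻¹`
  have e : conjR a X - conjR b X = conjR b (conjR (b⁻¹ * a) X - X) := by
    rw [conjR_sub, ← conjR_mul_left, mul_inv_cancel_left]
  rw [e]
  refine (norm_conjR_le hb1 _).trans ?_
  have hdev : ‖(((b⁻¹ * a : 𝔸ˣ)) : 𝔸) - 1‖ ≤ ε'' := by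
    have h1 : (((b⁻¹ * a : 𝔸ˣ)) : 𝔸) - 1 = ((b⁻¹ : 𝔸ˣ) : 𝔸) * (((a : 𝔸ˣ) : 𝔸) * (((b⁻¹ : 𝔸ˣ)) : 𝔸) - 1) * ((b : 𝔸ˣ) : 𝔸) := by
      rw [mul_sub, sub_mul, mul_one, Units.inv_mul, Units.val_mul, mul_assoc, mul_assoc, Units.inv_mul, mul_one]
    rw [h1]
    obtain ⟨hbn, hbin⟩ := mem_U1.1 hb1
    calc ‖((b⁻¹ : 𝔸ˣ) : 𝔸) * (((a : 𝔸ˣ) : 𝔸) * (((b⁻¹ : 𝔸ˣ)) : 𝔸) - 1) * ((b : 𝔸ˣ) : 𝔸)‖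
        ≤ ‖((b⁻¹ : 𝔸ˣ) : 𝔸)‖ * ‖((a : 𝔸ˣ) : 𝔸) * (((b⁻¹ : 𝔸ˣ)) : 𝔸) - 1‖ * ‖((b : 𝔸ˣ) : 𝔸)‖ :=
          (norm_mul_le _ _).trans (mul_le_mul_of_nonneg_right (norm_mul_le _ _) (norm_nonneg _))
      _ ≤ 1 * ε'' * 1 :=
          mul_le_mul (mul_le_mul hbin (hloop i.1 i.2.1) (norm_nonneg _) zero_le_one) hbn (norm_nonneg _)
            (by have hε0 : 0 ≤ ε'' := (norm_nonneg _).trans (hloop i.1 i.2.1); positivity)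
      _ = ε'' := by ring
  calc ‖conjR (b⁻¹ * a) X - X‖ ≤ 2 * ε'' * ‖X‖ := B7Prop3GeneralLinearBound.norm_conjR_sub_self_le ((U1 𝔸).mul_mem ((U1 𝔸).inv_mem hb1) (hol_mem hV₀ _ _)) hdev X
    _ ≤ 2 * ε'' * m := by
        have hε : 0 ≤ ε'' := (norm_nonneg _).trans (hloop i.1 i.2.1)
        gcongr
        exact hm _

/-- ★ **THE `hgauge` HYPOTHESIS OF `B7Prop4GaugeInductionRec.prop4_gauge_induction` FOR THE RECORD, VERBATIM SHAPE**: `Q̂(V₀)(d_{V₀}θ) + d_{V̄₀}(λ_{d_{V₀}θ}) = d_{V̄₀}(R̄θ)` — the full linear part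
`Q̂ + d_{V̄₀}∘λ` maps the covariant pure gauge `d_{V₀}θ` to the covariant pure gauge of the block mean `R̄θ` (under the small-loop guard). [cite: Balaban1985Averaging, (93) p.31, (124) p.36; Balaban1987RG1, (0.4) p.253] -/
theorem QhatZ_dcovF_add (hL : 1 ≤ L) (V₀ : SiteZ d → Fin d → 𝔸ˣ) (θ : SiteZ d → 𝔸) (q : SiteZ d) (κ : Fin d)
    (hW : ∀ i : IdxZ d L, ‖((WZ L V₀ q κ i : 𝔸ˣ) : 𝔸) - 1‖ < 1) :
    QhatZ L V₀ (dcovF V₀ θ) q κ + dcovZ L V₀ (lamZ L V₀ (dcovF V₀ θ)) q κ = dcovZ L V₀ (rlamZ L V₀ θ) q κ := by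
  rw [← linQcovZ_eq_QhatZ_add_dcovZ, linQcovZ_dcovF L hL V₀ θ q κ hW]

end Carry

/-! ## §5 The covariant curl of a covariant pure gauge is a holonomy defect -/

section Curl

omit [NormedAlgebra ℂ 𝔸] [NormOneClass 𝔸] [CompleteSpace 𝔸] in
/-- `(R_{0,x}(d_{V₀}μ))(∂p) = μ(x) − R(V₀(∂p))μ(x)` (the plaquette word is closed). [cite: Balaban1985Averaging, (44) p.24, (58) p.27] -/
theorem tsum_plaqWord_dcovF (V₀ : SiteZ d → Fin d → 𝔸ˣ) (μ : SiteZ d → 𝔸) (x : SiteZ d) (κ ν : Fin d) :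
    tsum V₀ (dcovF V₀ μ) x (plaqWord κ ν) = μ x - conjR (hol V₀ x (plaqWord κ ν)) (μ x) := by
  rw [tsum_dcovF]
  have : disp (plaqWord κ ν) = (0 : SiteZ d) := by
    simp [plaqWord, disp_cons, Letter.vec]
  rw [this, add_zero]

omit [NormedAlgebra ℂ 𝔸] [CompleteSpace 𝔸] in
/-- **`‖(R_{0,x}(d_{V₀}μ))(∂p)‖ ≤ 2|V₀(∂p) − 1|·|μ(x)|`** — the covariant curl of a covariant pure gauge is as small as the background's plaquette variables (so pure gauges carry no curvature
source on the road). [cite: Balaban1985Averaging, (44) p.24, (58) p.27] -/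
theorem norm_tsum_plaqWord_dcovF_le {V₀ : SiteZ d → Fin d → 𝔸ˣ} (hV₀ : ∀ x κ, V₀ x κ ∈ U1 𝔸) (μ : SiteZ d → 𝔸) (x : SiteZ d) (κ ν : Fin d)
    {α : ℝ} (hα : ‖((hol V₀ x (plaqWord κ ν) : 𝔸ˣ) : 𝔸) - 1‖ ≤ α) :
    ‖tsum V₀ (dcovF V₀ μ) x (plaqWord κ ν)‖ ≤ 2 * α * ‖μ x‖ := by
  rw [tsum_plaqWord_dcovF, ← norm_neg, neg_sub]
  exact B7Prop3GeneralLinearBound.norm_conjR_sub_self_le (hol_mem hV₀ _ _) hα _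

end Curl

end Literature.MathematicalPhysics.QuantumFieldTheory.Balaban1983to89.B7Prop3PureGaugeRec
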